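import Summits.BirchSwinnertonDyer.BirchSwinnertonDyer.Theorems.RamifiedHeegnerPairLeafPartnerOrdersBaseChangeCoordinates
import HarnessLib

/-!
# Route `RamifiedHeegnerPair`, crux U₁ `LeafRankOneUpperAtThree` (stmt-BirchSwinnertonDyer-26022), line `partnerdescent` —
# partner kernel, base change (α) part 4: OPERATORS — `ℤ[G]` acting on `B̂`, the twisted pairing `⟨x, W y⟩` and its invariance ∕ non-degeneracy

HONEST FRAMING. Theorems only; helper file (`--supports stmt-BirchSwinnertonDyer-26022 --as helper`); elementary linear algebra over Mathlib
continuing ‹…BaseChangeCoordinates›; no number theory, no named fact, no `sorry`; nothing booked; BSD is proved for no curve. Lead prover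
bsd-line-rhp-p2 g64, 2026-08-31.

WHY. Inputs of `dvd_of_generatorsRun` (p812855) that are pure coordinate algebra, isolated so that the (α) assembly stays short:
* `exists_ringHom_mulVec` — the action `ρ : ℤ[G] → End_S(M)` of the integral Hecke ring on `M = B̂` (`(ρ C m)^ = Ĉ·m`), for generators
  preserving the degree-zero lattice; packaged as an existence statement (no definition is introduced).
* `dotProduct_map_mulVec_of_transpose_mul` — INVARIANCE of the twisted pairing `β(x, y) = x·(P̂ y)`, `P = D_w·W` (Gross's `diag(w)` times an
  Atkin–Lehner permutation `W`; `W = 1` allowed): the integral matrix identity `Xᵀ·P = P·X` (i.e. `X† = W X W⁻¹` for the `w`-adjoint `†`;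
  for `W = 1`: weight symmetry `w_i X_ij = w_j X_ji`) gives `β(X̂ x, y) = β(x, X̂ y)` over any `S`. This is Mazur's device for the
  non-self-adjoint `U`-operators (the full Hecke algebra is needed for multiplicity one).
* `eq_zero_of_forall_wpair_eq_zero` — NON-DEGENERACY of Gross's pairing on the degree-zero module over a domain of characteristic `0`
  (`w_c x_c` constant and `Σ x = 0` force `x = 0`, WITHOUT dividing by the weights — `w_c = 3` occurs).
* `exists_linearMap_intCast` — an integral functional `Ψ : ℤ^ι → ℤ` read over `S` (`Ψ̂ ŷ = Ψ(y)^`).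
[cite: Mazur1977, II §15 (the `w`-twisted pairing)] [cite: Gross1987, §1–§2 (`⟨e_i, e_j⟩ = w_i δ_ij`)] [cite: BourbakiAlgebraI1989, Ch. II §2 no. 5–6]
-/

set_option linter.dupNamespace false
set_option autoImplicit false

noncomputable section

namespace Summit.BirchSwinnertonDyer.BirchSwinnertonDyer.Theorems.LeafPartnerOrders

open Matrix

variable {S : Type*} [CommRing S] {ι : Type*} [Fintype ι] [DecidableEq ι]

/-- **The integral Hecke ring acts on `B̂`.** If every generator `X ∈ G` preserves the degree-zero lattice and `M ≤ S^ι` is the degree-zero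
module, there is a ring homomorphism `ρ : ℤ[G] → End_S M` with `(ρ C m)^ = Ĉ·m`. [cite: BourbakiAlgebraI1989, Ch. II §2 no. 5] -/
theorem exists_ringHom_mulVec (M : Submodule S (ι → S)) (hM : ∀ v : ι → S, v ∈ M ↔ ∑ c, v c = 0) (G : Set (Matrix ι ι ℤ))
    (hG : ∀ X ∈ G, ∀ v : ι → ℤ, ∑ c, v c = 0 → ∑ c, (X *ᵥ v) c = 0) :
    ∃ ρ : Algebra.adjoin ℤ G →+* Module.End S M,
      ∀ (C : Algebra.adjoin ℤ G) (m : M), ((ρ C m : M) : ι → S) = (C : Matrix ι ι ℤ).map (Int.castRingHom S) *ᵥ (m : ι → S) := by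
  classical
  have hpres : ∀ (C : Algebra.adjoin ℤ G), ∀ m ∈ M, ((C : Matrix ι ι ℤ).map (Int.castRingHom S)).mulVecLin m ∈ M := by
    intro C m hm
    rw [hM]
    exact sum_map_mulVec_eq_zero (forall_sum_mulVec_eq_zero_of_mem_adjoin hG C.2) m ((hM m).mp hm)
  let ρ₀ : Algebra.adjoin ℤ G → Module.End S M := fun C ↦ ((C : Matrix ι ι ℤ).map (Int.castRingHom S)).mulVecLin.restrict (hpres C)
  have hρ₀ : ∀ (C : Algebra.adjoin ℤ G) (m : M), ((ρ₀ C m : M) : ι → S) = (C : Matrix ι ι ℤ).map (Int.castRingHom S) *ᵥ (m : ι → S) :=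
    fun C m ↦ rfl
  refine ⟨{ toFun := ρ₀, map_one' := ?_, map_mul' := ?_, map_zero' := ?_, map_add' := ?_ }, fun C m ↦ hρ₀ C m⟩
  · apply LinearMap.ext; intro m; apply Subtype.ext
    rw [hρ₀, Subalgebra.coe_one, Matrix.map_one _ (map_zero _) (map_one _), one_mulVec]; rfl
  · intro C C'; apply LinearMap.ext; intro m; apply Subtype.ext
    rw [hρ₀, Module.End.mul_apply, hρ₀, hρ₀, Subalgebra.coe_mul, Matrix.map_mul, mulVec_mulVec]
  · apply LinearMap.ext; intro m; apply Subtype.ext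
    rw [hρ₀, Subalgebra.coe_zero, Matrix.map_zero _ (map_zero _), zero_mulVec]; rfl
  · intro C C'; apply LinearMap.ext; intro m; apply Subtype.ext
    rw [hρ₀, LinearMap.add_apply, Submodule.coe_add, hρ₀, hρ₀, Subalgebra.coe_add, Matrix.map_add _ (map_add _), add_mulVec]

omit [DecidableEq ι] in
/-- **Invariance of the twisted pairing from the integral adjoint identity.** If `Xᵀ·P = P·X` as integer matrices, then over any `S`:
`(X̂ x)·(P̂ y) = x·(P̂ (X̂ y))`. With `P = diag(w)·W` this is `⟨X x, W y⟩_w = ⟨x, W X y⟩_w`, i.e. the `w`-adjoint of `X` is `W X W⁻¹`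
(`W = 1`: `X` is `w`-symmetric). [cite: Mazur1977, II §15] -/
theorem dotProduct_map_mulVec_of_transpose_mul {X P : Matrix ι ι ℤ} (h : Xᵀ * P = P * X) (x y : ι → S) :
    (X.map (Int.castRingHom S) *ᵥ x) ⬝ᵥ (P.map (Int.castRingHom S) *ᵥ y) =
      x ⬝ᵥ (P.map (Int.castRingHom S) *ᵥ (X.map (Int.castRingHom S) *ᵥ y)) := by
  have h' : (X.map (Int.castRingHom S))ᵀ * P.map (Int.castRingHom S) = P.map (Int.castRingHom S) * X.map (Int.castRingHom S) := by
    rw [← Matrix.transpose_map, ← Matrix.map_mul, h, Matrix.map_mul]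
  rw [mulVec_mulVec, ← h', ← mulVec_mulVec]
  conv_rhs => rw [dotProduct_mulVec, vecMul_transpose]

omit [DecidableEq ι] in
/-- **Non-degeneracy of Gross's pairing on the degree-zero module** over a domain of characteristic zero: if `Σ x = 0` and
`Σ_c w_c x_c z_c = 0` for every `z` of degree zero, then `x = 0`. (The `w_c x_c` are all equal to some `κ`; then
`0 = L·Σ x_c = κ·Σ_c L/w_c` with `L = ∏ w`, and `Σ_c L/w_c > 0`.) No division by the weights. [cite: Gross1987, §1–§2] -/
theorem eq_zero_of_forall_wpair_eq_zero [IsDomain S] [CharZero S] (w : ι → ℕ) (hw : ∀ c, 0 < w c) (x : ι → S)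
    (hx : ∑ c, x c = 0) (h : ∀ z : ι → S, ∑ c, z c = 0 → ∑ c, (w c : S) * x c * z c = 0) : x = 0 := by
  classical
  by_cases hι : Nonempty ι
  swap
  · rw [not_nonempty_iff] at hι; funext c; exact (IsEmpty.false c).elim
  obtain ⟨c₀⟩ := hι
  -- all `w_c x_c` are equal
  have hconst : ∀ c, (w c : S) * x c = (w c₀ : S) * x c₀ := by
    intro c
    by_cases hc : c = c₀
    · rw [hc]
    have h1 := h (Pi.single c 1 - Pi.single c₀ 1) (by simp [Finset.sum_sub_distrib])
    simp only [Pi.sub_apply, Pi.single_apply, mul_sub, mul_ite, mul_one, mul_zero, Finset.sum_sub_distrib,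
      Finset.sum_ite_eq', Finset.mem_univ, if_true] at h1
    exact sub_eq_zero.mp h1
  -- `L = ∏ w`, `L/w_c` as a natural number
  let L : ℕ := ∏ c, w c
  have hLdiv : ∀ c, w c ∣ L := fun c ↦ Finset.dvd_prod_of_mem _ (Finset.mem_univ c)
  have hL : ∀ c, ((L / w c : ℕ) : S) * (w c : S) = (L : S) := fun c ↦ by
    rw [← Nat.cast_mul, Nat.div_mul_cancel (hLdiv c)]
  have hsum : (∑ c, ((L / w c : ℕ) : S)) * ((w c₀ : S) * x c₀) = (L : S) * ∑ c, x c := by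
    rw [Finset.sum_mul, Finset.mul_sum]
    refine Finset.sum_congr rfl fun c _ ↦ ?_
    rw [← hconst c, ← mul_assoc, hL c]
  rw [hx, mul_zero] at hsum
  have hpos : (∑ c, ((L / w c : ℕ) : S)) ≠ 0 := by
    have : 0 < ∑ c, (L / w c : ℕ) :=
      Finset.sum_pos (fun c _ ↦ Nat.div_pos (Nat.le_of_dvd (Finset.prod_pos fun c _ ↦ hw c) (hLdiv c)) (hw c))
        ⟨c₀, Finset.mem_univ _⟩
    rw [← Nat.cast_sum]
    exact_mod_cast this.ne'
  have hκ : (w c₀ : S) * x c₀ = 0 := (mul_eq_zero.mp hsum).resolve_left hpos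
  funext c
  have hc := hconst c
  rw [hκ] at hc
  have hwc : (w c : S) ≠ 0 := by exact_mod_cast (hw c).ne'
  exact (mul_eq_zero.mp hc).resolve_left hwc

/-- **An integral functional read over `S`**: `Ψ̂(v) = Σ_d Ψ(e_d)·v_d` satisfies `Ψ̂ ŷ = Ψ(y)^`. [cite: BourbakiAlgebraI1989, Ch. II §2 no. 6] -/
theorem exists_linearMap_intCast (Ψ : (ι → ℤ) →ₗ[ℤ] ℤ) :
    ∃ Ψ' : (ι → S) →ₗ[S] S, ∀ y : ι → ℤ, Ψ' (fun c ↦ (y c : S)) = ((Ψ y : ℤ) : S) := by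
  classical
  refine ⟨∑ d, ((Ψ (Pi.single d 1) : ℤ) : S) • LinearMap.proj d, fun y ↦ ?_⟩
  rw [LinearMap.pi_apply_eq_sum_univ Ψ y]
  simp only [LinearMap.sum_apply, LinearMap.smul_apply, LinearMap.proj_apply, smul_eq_mul, Int.cast_sum, Int.cast_mul]
  refine Finset.sum_congr rfl fun d _ ↦ ?_
  have hsingle : (Pi.single d 1 : ι → ℤ) = fun j ↦ if d = j then 1 else 0 := by
    funext j
    simp [Pi.single_apply, eq_comm]
  rw [mul_comm, hsingle]

end Summit.BirchSwinnertonDyer.BirchSwinnertonDyer.Theorems.LeafPartnerOrders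

end
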